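import Literature.AlgebraicGeometry.Hu2025.Statements.S07GammaSchemes.R109cThetaWpEllTransforms
import Literature.AlgebraicGeometry.Hu2025.Proofs.S07GammaSchemes.Lem73BaseMaximality
import Literature.AlgebraicGeometry.Hu2025.Proofs.S07GammaSchemes.StrictTransformShape
import Mathlib.Algebra.MvPolynomial.CommRing
import Mathlib.RingTheory.Ideal.Quotient.Operations
import Mathlib.Tactic.FinCases
import Mathlib.Tactic.Ring
import HarnessLib

/-!
# Hu 2025 (arXiv:2507.21400v1) §7.3, the in-proof inference C61L10–L15 (p.136) «ϑ′_{[k]} = {y′_0, y′_1} ⊂ Γ̃⁰_{𝔙′} because Z̃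
# is contained in the proper transform Z′_{ϑ[k]}» (typed `C61L12`, row 109 file c) — KERNEL SUPPORT: non-vacuity and
# reading-dependence on the toy chart of `Lem73BaseMaximality.lean`

**Honest framing (D-0012/D-0089).** Kernel facts about the TYPED inference `C61L12 var′ y0′ y1′ D′ : Prop :=
⟨var′ y0′, var′ y1′⟩ ≤ √I(Z̃′ ∩ 𝔙′) → y0′ ∈ Γ̃⁰_{𝔙′} ∧ y1′ ∈ Γ̃⁰_{𝔙′}` on ONE toy instance (n = 5, Γ = {x₁₂₄, x₁₃₄}, the
chart data `D0` / `D1` of `Lem73BaseMaximality.lean`, which share the chart ideal `I_{℘,Γ}` and differ only in the `Γ̃⁰`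
slot: `Γ̃⁰ := Γ` as C57L151 prints vs `Γ̃⁰ := gamma0Sat = {x₁₂₄, x₁₃₄, x₁₄₅}`); taking no side on the manuscript [Hu2025]
(arXiv:2507.21400v1, `paper:arxiv-2507.21400`, UNREFEREED, under adjudication at rung M-Hu-min of the campaign `res-hironaka`).
Provenance: res-type-016 (typer of record of row 109).
* `not_C61L12_D0` — with the pair `(y′_0, y′_1) = (x₁₄₅, x₁₂₄)` (both vanish on `Z_Γ`, even scheme-theoretically) the typed
  inference FAILS for `Γ̃⁰ := Γ` (`x₁₄₅ ∉ Γ`);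
* `C61L12_D1` — and HOLDS for `Γ̃⁰ := {x₁₂₄, x₁₃₄, x₁₄₅}`.
General lemma first: `GammaTransformChart.c61L12_of_gamma0Maximal` — C61L12 is DERIVED (kernel) from the claim reading of the maximality clause
at stage k−1 plus scheme-theoretic vanishing of y′_0, y′_1 (hypotheses named); `…_of_isRadical` — on a reduced chart the second
hypothesis is automatic. So, as typed, C61L12 is neither vacuous nor a
tautology, and its truth on a given chart ideal depends on the `Γ̃⁰` reading —
the same reading question as the maximality clause (see `ChartReadings.lean`). Nothing here decides that question.

## References
* [Hu2025] Y. Hu, arXiv:2507.21400v1 (2025), Lem. 7.4 proof C60L107–C61L27 (p.135–136), Lem. 7.3 proof C57L144–L153 (p.130) —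
  loci of the typed definitions only (unrefereed manuscript under adjudication).
-/

noncomputable section

namespace Literature.AlgebraicGeometry.Hu2025.Statements.S07GammaSchemes

namespace GammaTransformChart

variable {V' : Type*} {A' : Type*} [CommRing A'] {ι' : Type*}

/-- **`C61L12` is DERIVED (kernel) from the claim reading of the maximality clause at stage `k − 1` PLUS scheme-theoretic vanishing of the
two centre variables** (general, any chart data): if `Γ̃⁰_{𝔙′}` is maximal (`Gamma0Maximal`, equivalently `Gamma0Greatest` /
`gamma0Sat ⊆ Γ̃⁰`, see `ChartReadings.lean`) and the radical membership of `y′_0, y′_1` upgrades to membership in `I(Z̃′ ∩ 𝔙′)`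
(hypothesis `hrad`, e.g. `Z̃′ ∩ 𝔙′` reduced along these variables), then the typed inference `C61L12` holds. Without `hrad` the
set-theoretic case hypothesis only gives radical membership; without maximality see `Lem73BaseToy.not_C61L12_D0`.
[cite: Hu2025, Lem. 7.4 proof C61L10–L15 with Lem. 7.4 (1) C60L15–L17; p.134–136 (unrefereed manuscript under adjudication — kernel support over the typed shapes; hypotheses explicit and named, nothing of the manuscript asserted)] -/
theorem c61L12_of_gamma0Maximal [DecidableEq V'] (D' : GammaTransformChart V' A') {var' val1 : V' → A'} {rels : ι' → A'}
    (hmax : D'.Gamma0Maximal var' val1 rels) (y0' y1' : V')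
    (hrad : ∀ y : V', var' y ∈ D'.zIdeal.radical → var' y ∈ D'.zIdeal) : C61L12 var' y0' y1' D' := by
  intro hle
  have h0 : var' y0' ∈ D'.zIdeal.radical := hle (Ideal.subset_span (by simp))
  have h1 : var' y1' ∈ D'.zIdeal.radical := hle (Ideal.subset_span (by simp))
  have key := (gamma0Maximal_iff D' hmax.1).mp hmax
  exact ⟨key y0' (hrad y0' h0), key y1' (hrad y1' h1)⟩

/-- **Variant on a REDUCED chart**: if `I(Z̃′ ∩ 𝔙′)` is a radical ideal (the text treats `Z̃_{ϑ[k−1],Γ} ∩ 𝔙′` through its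
defining equations; reducedness is NOT stated in print — an explicit hypothesis here), the upgrade hypothesis `hrad` of
`c61L12_of_gamma0Maximal` is automatic, so `C61L12` follows from the maximality clause at stage `k − 1` alone.
[cite: Hu2025, Lem. 7.4 proof C61L10–L15 with Lem. 7.4 (1) C60L15–L17; p.134–136 (unrefereed manuscript under adjudication — kernel support over the typed shapes; hypotheses explicit and named, nothing of the manuscript asserted)] -/
theorem c61L12_of_gamma0Maximal_of_isRadical [DecidableEq V'] (D' : GammaTransformChart V' A') {var' val1 : V' → A'}
    {rels : ι' → A'} (hmax : D'.Gamma0Maximal var' val1 rels) (hred : D'.zIdeal.IsRadical) (y0' y1' : V') :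
    C61L12 var' y0' y1' D' :=
  c61L12_of_gamma0Maximal D' hmax y0' y1' fun _ hy => hred hy

end GammaTransformChart

namespace Lem73BaseToy

open MvPolynomial GammaTransformChart

/-- The hypothesis of `C61L12` holds on the toy chart ideal for the pair `(x₁₄₅, x₁₂₄)`: both lie in `I_{℘,Γ}`, a fortiori
in its radical. [cite: Hu2025, Lem. 7.4 proof C61L10–L15; p.136 (unrefereed manuscript under adjudication — kernel support on a toy instance, nothing of the manuscript asserted)] -/
theorem span_pair_le_radical : Ideal.span {(X 4 : R), X 0} ≤ (I).radical := by
  rw [Ideal.span_le]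
  rintro x hx
  rcases hx with rfl | rfl
  · exact Ideal.le_radical X4_mem
  · exact Ideal.le_radical (by simpa using X0_mem)

/-- **`C61L12` FAILS for the `k = 0` data `Γ̃⁰ := Γ`** (pair `(x₁₄₅, x₁₂₄)`): `x₁₄₅` vanishes on `Z_Γ` but `x₁₄₅ ∉ Γ`.
[cite: Hu2025, Lem. 7.4 proof C61L10–L15 with Lem. 7.3 proof C57L151; p.130, p.136 (unrefereed manuscript under adjudication — kernel fact about the typed inference on a toy instance, nothing of the manuscript asserted or denied)] -/
theorem not_C61L12_D0 : ¬ C61L12 (X : Fin 9 → R) 4 0 D0 := by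
  intro h
  have h4 := (h span_pair_le_radical).1
  simp [D0, Γ] at h4

/-- **`C61L12` HOLDS for `Γ̃⁰ := {x₁₂₄, x₁₃₄, x₁₄₅}`** (same chart ideal, same pair).
[cite: Hu2025, Lem. 7.4 proof C61L10–L15; p.136 (unrefereed manuscript under adjudication — kernel fact about the typed inference on a toy instance, nothing asserted or denied)] -/
theorem C61L12_D1 : C61L12 (X : Fin 9 → R) 4 0 D1 := fun _ => ⟨by simp [D1], by simp [D1]⟩

end Lem73BaseToy

end Literature.AlgebraicGeometry.Hu2025.Statements.S07GammaSchemes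

end

/-!
# Hu 2025 (arXiv:2507.21400v1) §7.3, the in-proof inference of Lemma 7.4 (1) (C60L71–L79, p.135; typed `C60L75`, row 109 file
# c; JOINT J3 = G-H2) — KERNEL SUPPORT: the typed SHAPE is not a tautology (a three-variable instance where both hypotheses hold,
# `pt` is the Def.-5.4-shaped operation on the listed equations, and the conclusion fails)

**Honest framing (D-0012/D-0089).** A kernel fact about the TYPED inference shape
`C60L75 π ζ pt rels′ D′ D : Prop := (I(Z̃′∩𝔙′) = ⟨rels′⟩) → (I(Z̃∩𝔙) = ⨆ₙ ((I(Z̃′∩𝔙′)·A) : ζⁿ)) → I(Z̃∩𝔙) = ⟨pt ∘ rels′⟩` on ONE toy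
instance that is NOT one of Hu's charts: it shows that the shape, read for arbitrary chart data, has false instances even when `pt`
divides the pull-back of each listed equation by the right power of `ζ` (Def. 5.4, C35L19–L42) — so a verdict on HU-R02 has to use
the SPECIFIC equations ℬ^gov, ℬ^ngv, ℬ^frb, L of Hu's charts (rows 103–108), which this file does not touch. It takes no side on
the manuscript [Hu2025] (arXiv:2507.21400v1, `paper:arxiv-2507.21400`, UNREFEREED, under adjudication at rung M-Hu-min of the
campaign `res-hironaka`); the prior one-cell record's toy of the same phenomenon (HU-GAP §2 G-H2, «𝔸³_{a,b,t}») is INDEX only.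
Provenance: res-type-016 (typer of record of row 109). Companion: `StrictTransformShape.lean` (the inclusion
`⟨pt ∘ rels′⟩ ≤ I(Z̃∩𝔙)` always holds for Def.-5.4-shaped `pt`). FIRST an exact criterion (any rings):
`GammaTransformChart.C60L75_conclusion_iff_saturated` — under the two hypotheses the conclusion of `C60L75` holds IFF `⟨pt ∘ rels′⟩`
is ζ-saturated (`x·ζ ∈ J → x ∈ J`); `C60L75_iff_saturated` restates the typed inference through it. So «what the sentence would
need» on a given chart is ζ-saturatedness of the ideal of the specific transformed families (sufficient: that ideal is prime with
ζ outside it — `saturated_of_isPrime`; or radical with ζ in none of its minimal primes — `saturated_of_isRadical`) — nothing here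
says whether Hu's charts have it.

The instance: `A′ = A = ℚ[a, b, t]` (indices `0, 1, 2`), centre `{a, b}`, chart `ζ = a`, pull-back `π : a ↦ a, b ↦ a·b, t ↦ t`;
listed equations `r₁ = a·t − b²` (a binomial), `r₂ = t`; Def.-5.4-shaped transforms `pt r₁ = (π r₁)/ζ = t − a·b²`
(`l_{φ,r₁} = min(1, 2) = 1`), `pt r₂ = π r₂ = t`. Then `I(Z̃′) = ⟨r₁, r₂⟩`, its strict transform contains `b²`
(`b²·ζ² = ζ·π r₂ − π r₁`), but `b² ∉ ⟨t − a·b², t⟩` (evaluate at `a = t = 0`, `b = 1`).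

## References
* [Hu2025] Y. Hu, arXiv:2507.21400v1 (2025), Def. 5.4 C35L13–L42 (p.80), Lem. 7.4 (1) proof C60L71–L79 (p.135) — loci of the typed
  definitions only (unrefereed manuscript under adjudication).
-/

noncomputable section

namespace Literature.AlgebraicGeometry.Hu2025.Statements.S07GammaSchemes

/-! ### An exact criterion for the `C60L75` shape: the conclusion holds iff the ideal of the transformed equations is ζ-saturated -/

namespace GammaTransformChart

variable {V V' : Type*} {A A' : Type*} [CommRing A] [CommRing A'] {ι : Type*}

/-- If `J` is `ζ`-saturated (`x·ζ ∈ J → x ∈ J`) then `x·ζⁿ ∈ J → x ∈ J`. [cite: Hu2025, Lem. 7.4 (1) proof C60L71–L79; p.135 (unrefereed manuscript under adjudication — kernel support, elementary algebra, nothing asserted)] -/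
theorem mem_of_mul_pow_mem_of_saturated {J : Ideal A} {ζ : A} (hsat : ∀ x, x * ζ ∈ J → x ∈ J) {x : A} {n : ℕ}
    (hx : x * ζ ^ n ∈ J) : x ∈ J := by
  induction n generalizing x with
  | zero => simpa using hx
  | succ n ih =>
    apply ih
    apply hsat
    rw [mul_assoc, ← pow_succ]
    exact hx

/-- **Exact criterion for the typed inference shape `C60L75`** (what the sentence C60L71–L79 would need, chart by chart): under
its two hypotheses — `I(Z̃′ ∩ 𝔙′) = ⟨rels′⟩` and `I(Z̃ ∩ 𝔙)` = the strict transform `⨆ₙ ((I(Z̃′ ∩ 𝔙′)·A) : ζⁿ)` — and for a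
Def.-5.4-shaped `pt` (`pt (rels′ i) · ζ^{nᵢ} = π (rels′ i)`), the conclusion «`Z̃ ∩ 𝔙` is defined by the proper transforms
`pt ∘ rels′` of the equations» holds IF AND ONLY IF the ideal `⟨pt ∘ rels′⟩` is `ζ`-saturated (`x·ζ ∈ ⟨pt ∘ rels′⟩ → x ∈ ⟨pt ∘ rels′⟩`,
i.e. `V(pt ∘ rels′)` has no extra component inside the exceptional divisor `(ζ = 0)`). Reason: `I′·A ≤ ⟨pt ∘ rels′⟩ ≤ sat(I′·A)`
always (`span_properTransforms_le_zIdeal`), and the saturation of the middle term is the outer one. So a verdict on HU-R02 at a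
chart amounts to checking ζ-saturatedness of the ideal of the SPECIFIC transformed families ℬ^gov, ℬ^ngv, ℬ^frb, L, Γ̃-part of
Hu's charts (rows 103–108) — a standard-basis-type condition, not automatic (`C60L75Toy.not_C60L75_toy`).
[cite: Hu2025, Lem. 7.4 (1) C60L4–L17 with proof C60L71–L79 and Def. 5.4 C35L19–L42; p.80, p.134–135 (unrefereed manuscript under adjudication — kernel fact about the typed shape of the inference: an equivalent reformulation, hypotheses explicit; nothing of the manuscript asserted or denied)] -/
theorem C60L75_conclusion_iff_saturated (π : A' →+* A) (ζ : A) (pt : A' → A) (rels' : ι → A')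
    (D' : GammaTransformChart V' A') (D : GammaTransformChart V A)
    (h' : D'.zIdeal = Ideal.span (Set.range rels'))
    (h : D.zIdeal = ⨆ n : ℕ, (D'.zIdeal.map π).colon ({ζ ^ n} : Set A))
    (hpt : ∀ i, ∃ n : ℕ, pt (rels' i) * ζ ^ n = π (rels' i)) :
    D.zIdeal = Ideal.span (Set.range (pt ∘ rels')) ↔
      ∀ x, x * ζ ∈ Ideal.span (Set.range (pt ∘ rels')) → x ∈ Ideal.span (Set.range (pt ∘ rels')) := by
  constructor
  · intro hconc x hx
    rw [← hconc] at hx ⊢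
    rw [h] at hx ⊢
    exact mem_saturation_of_mul_pow_mem π ζ D'.zIdeal (m := 1) (by simpa using hx)
  · intro hsat
    apply le_antisymm
    · rw [h]
      intro x hx
      have hdir : Directed (· ≤ ·) fun n : ℕ => (D'.zIdeal.map π).colon ({ζ ^ n} : Set A) :=
        (colon_pow_mono (D'.zIdeal.map π) ζ).directed_le
      obtain ⟨n, hn⟩ := (Submodule.mem_iSup_of_directed _ hdir).mp hx
      rw [Submodule.mem_colon_singleton, smul_eq_mul] at hn
      have hmap : D'.zIdeal.map π ≤ Ideal.span (Set.range (pt ∘ rels')) := by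
        rw [h', Ideal.map_span, Ideal.span_le]
        rintro _ ⟨_, ⟨i, rfl⟩, rfl⟩
        obtain ⟨k, hk⟩ := hpt i
        rw [SetLike.mem_coe, ← hk]
        exact Ideal.mul_mem_right _ _ (Ideal.subset_span ⟨i, rfl⟩)
      exact mem_of_mul_pow_mem_of_saturated hsat (hmap hn)
    · exact span_properTransforms_le_zIdeal π ζ pt rels' D' D h' h hpt

/-- The typed inference `C60L75` itself, restated through the criterion: it holds iff (its two hypotheses imply that)
`⟨pt ∘ rels′⟩` is `ζ`-saturated. [cite: Hu2025, Lem. 7.4 (1) proof C60L71–L79; p.135 (unrefereed manuscript under adjudication — kernel reformulation of the typed shape, nothing of the manuscript asserted or denied)] -/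
theorem C60L75_iff_saturated (π : A' →+* A) (ζ : A) (pt : A' → A) (rels' : ι → A')
    (D' : GammaTransformChart V' A') (D : GammaTransformChart V A)
    (hpt : ∀ i, ∃ n : ℕ, pt (rels' i) * ζ ^ n = π (rels' i)) :
    C60L75 π ζ pt rels' D' D ↔
      (D'.zIdeal = Ideal.span (Set.range rels') →
        D.zIdeal = (⨆ n : ℕ, (D'.zIdeal.map π).colon ({ζ ^ n} : Set A)) →
          ∀ x, x * ζ ∈ Ideal.span (Set.range (pt ∘ rels')) → x ∈ Ideal.span (Set.range (pt ∘ rels'))) := by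
  unfold C60L75
  exact forall_congr' fun h' => forall_congr' fun h => C60L75_conclusion_iff_saturated π ζ pt rels' D' D h' h hpt

/-- **Usable sufficient condition (1)**: a PRIME ideal not containing `ζ` is `ζ`-saturated — so if the transformed equations
generate a prime ideal at the chart and `ζ ∉ ⟨pt ∘ rels′⟩` (the locus they cut out is integral and not inside the exceptional
divisor), the `C60L75` conclusion holds there (`C60L75_conclusion_iff_saturated`).
[cite: Hu2025, Lem. 7.4 (1) proof C60L71–L79; p.135 (unrefereed manuscript under adjudication — kernel support, elementary algebra; nothing of the manuscript asserted)] -/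
theorem saturated_of_isPrime {J : Ideal A} (hJ : J.IsPrime) {ζ : A} (hζ : ζ ∉ J) :
    ∀ x, x * ζ ∈ J → x ∈ J :=
  fun _ hx => (hJ.mem_or_mem hx).resolve_right hζ

/-- **Usable sufficient condition (2)**: a RADICAL ideal none of whose minimal primes contains `ζ` is `ζ`-saturated — i.e. if
the transformed equations cut out a REDUCED subscheme of the chart no irreducible component of which lies in the exceptional
divisor `(ζ = 0)`, the `C60L75` conclusion holds there. (Both conditions are about Hu's specific families; not checked here.)
[cite: Hu2025, Lem. 7.4 (1) proof C60L71–L79; p.135 (unrefereed manuscript under adjudication — kernel support, elementary algebra; nothing of the manuscript asserted)] -/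
theorem saturated_of_isRadical {J : Ideal A} (hrad : J.IsRadical) {ζ : A}
    (hζ : ∀ p ∈ J.minimalPrimes, ζ ∉ p) : ∀ x, x * ζ ∈ J → x ∈ J := by
  intro x hx
  have hxrad : x ∈ J.radical := by
    rw [← Ideal.sInf_minimalPrimes, Submodule.mem_sInf]
    intro p hp
    exact ((hp.1.1).mem_or_mem (hp.1.2 hx)).resolve_right (hζ p hp)
  exact hrad hxrad

end GammaTransformChart

namespace C60L75Toy

open MvPolynomial GammaTransformChart

/-- `ℚ[a, b, t]`, indices `0 ↦ a`, `1 ↦ b`, `2 ↦ t`. [cite: Hu2025, Lem. 7.4 (1) proof C60L71–L79; p.135 (unrefereed manuscript under adjudication — kernel support on a toy instance, nothing of the manuscript asserted)] -/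
abbrev A : Type := MvPolynomial (Fin 3) ℚ

/-- The pull-back of the chart `ζ = a` of the blow-up of `{a = b = 0}`: `a ↦ a`, `b ↦ a·b`, `t ↦ t` (shape of row 106
`ChartStep.pullback`). [cite: Hu2025, Prop. 5.3 / Def. 5.4 C34L146–C35L29; p.80 (unrefereed manuscript under adjudication — kernel support on a toy instance, nothing asserted)] -/
def π : A →ₐ[ℚ] A := aeval fun i => if i = 1 then X 0 * X 1 else X i

/-- `r₁ = a·t − b²`. [cite: Hu2025, Lem. 7.4 (1) C60L4–L13; p.134 (unrefereed manuscript under adjudication — kernel support on a toy instance, nothing asserted)] -/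
def r1 : A := X 0 * X 2 - X 1 ^ 2

/-- `r₂ = t`. [cite: Hu2025, Lem. 7.4 (1) C60L4–L13; p.134 (unrefereed manuscript under adjudication — kernel support on a toy instance, nothing asserted)] -/
def r2 : A := X 2

/-- The listed equations `rels′ = (r₁, r₂)`. [cite: Hu2025, Lem. 7.4 (1) C60L4–L13; p.134 (unrefereed manuscript under adjudication — kernel support on a toy instance, nothing asserted)] -/
def rels' (j : Fin 2) : A := if j = 0 then r1 else r2

/-- The Def.-5.4-shaped «proper transform of an equation»: `r₁ ↦ (π r₁)/ζ = t − a·b²` (`l_{φ,r₁} = 1`), any other `f ↦ π f`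
(in particular `r₂ ↦ t`). [cite: Hu2025, Def. 5.4 C35L19–L42; p.80 (unrefereed manuscript under adjudication — kernel support on a toy instance, nothing asserted)] -/
def pt (f : A) : A := @ite _ (f = r1) (Classical.dec _) (X 2 - X 0 * X 1 ^ 2) (π f)

/-- The strict transform (ζ-saturation, `ζ = a`) of `⟨r₁, r₂⟩` — the `C60L53` reading of «proper transform of Z̃′».
[cite: Hu2025, Lem. 7.4 proof C60L47–L55; p.135 (unrefereed manuscript under adjudication — kernel support on a toy instance, nothing asserted)] -/
def sat : Ideal A := ⨆ n : ℕ, ((Ideal.span (Set.range rels')).map (π : A →+* A)).colon ({(X 0 : A) ^ n} : Set A)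

/-- The chart data of `Z̃′ ∩ 𝔙′`: chart ideal `⟨r₁, r₂⟩` (the other fields play no role in `C60L75`).
[cite: Hu2025, Lem. 7.4 (1) C60L4–L13; p.134 (unrefereed manuscript under adjudication — kernel support on a toy instance, nothing asserted)] -/
def D' : GammaTransformChart (Fin 3) A := ⟨Ideal.span (Set.range rels'), Ideal.span (Set.range rels'), ∅, ∅⟩

/-- The chart data of `Z̃ ∩ 𝔙`: chart ideal = the strict transform `sat`. [cite: Hu2025, Lem. 7.4 proof C60L47–L55; p.135 (unrefereed manuscript under adjudication — kernel support on a toy instance, nothing asserted)] -/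
def D : GammaTransformChart (Fin 3) A := ⟨sat, sat, ∅, ∅⟩

/-- Evaluation at `a = 0`, `b = 1`, `t = 0`. [cite: Hu2025, Lem. 7.4 (1) proof C60L71–L79; p.135 (unrefereed manuscript under adjudication — kernel support on a toy instance, nothing asserted)] -/
def ev : A →+* ℚ := (MvPolynomial.eval fun i => if i = 1 then (1 : ℚ) else 0 : A →+* ℚ)

/-- `r₂ ≠ r₁` (they differ at `a = t = 0`, `b = 1`). [cite: Hu2025, Lem. 7.4 (1) C60L4–L13; p.134 (unrefereed manuscript under adjudication — kernel support on a toy instance, nothing asserted)] -/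
theorem r2_ne_r1 : r2 ≠ r1 := by
  intro h
  have := congrArg ev h
  simp [ev, r1, r2] at this

/-- `pt r₁ = t − a·b²` and `pt r₂ = t`. [cite: Hu2025, Def. 5.4 C35L19–L42; p.80 (unrefereed manuscript under adjudication — kernel support on a toy instance, nothing asserted)] -/
theorem pt_rels' : pt r1 = X 2 - X 0 * X 1 ^ 2 ∧ pt r2 = X 2 := by
  refine ⟨by simp [pt], ?_⟩
  rw [pt, if_neg r2_ne_r1]
  simp [π, r2]

/-- `pt` IS the Def.-5.4 operation on the listed equations: `pt r₁ · ζ = π r₁` (division by `ζ^{l}`, `l = 1`) and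
`pt r₂ = π r₂` (`l = 0`). [cite: Hu2025, Def. 5.4 C35L30–L36 «B_𝔙 = (π^* B_𝔙′)/ζ^{l_{φ,B}}»; p.80 (unrefereed manuscript under adjudication — kernel support on a toy instance, nothing asserted)] -/
theorem pt_shape : pt r1 * X 0 = π r1 ∧ pt r2 = π r2 := by
  refine ⟨?_, ?_⟩
  · rw [pt_rels'.1]
    simp [π, r1]
    ring
  · rw [pt_rels'.2]
    simp [π, r2]

/-- `b²` lies in the strict transform: `b² · ζ² = ζ · π r₂ − π r₁ ∈ ⟨r₁, r₂⟩·A`.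
[cite: Hu2025, Lem. 7.4 proof C60L47–L55 / C60L71–L79; p.135 (unrefereed manuscript under adjudication — kernel support on a toy instance, nothing asserted)] -/
theorem X1_sq_mem_sat : (X 1 ^ 2 : A) ∈ sat := by
  refine Submodule.mem_iSup_of_mem 2 ?_
  rw [Submodule.mem_colon_singleton, smul_eq_mul]
  have h1 : π r1 ∈ (Ideal.span (Set.range rels')).map (π : A →+* A) :=
    Ideal.mem_map_of_mem _ (Ideal.subset_span ⟨0, by simp [rels']⟩)
  have h2 : π r2 ∈ (Ideal.span (Set.range rels')).map (π : A →+* A) :=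
    Ideal.mem_map_of_mem _ (Ideal.subset_span ⟨1, by simp [rels']⟩)
  have key : (X 1 ^ 2 * X 0 ^ 2 : A) = X 0 * π r2 - π r1 := by
    simp [π, r1, r2]
    ring
  rw [key]
  exact Ideal.sub_mem _ (Ideal.mul_mem_left _ _ h2) h1

/-- `b² ∉ ⟨t − a·b², t⟩` (evaluate at `a = t = 0`, `b = 1`). [cite: Hu2025, Lem. 7.4 (1) proof C60L71–L79; p.135 (unrefereed manuscript under adjudication — kernel support on a toy instance, nothing asserted)] -/
theorem X1_sq_notMem_span_pt : (X 1 ^ 2 : A) ∉ Ideal.span (Set.range (pt ∘ rels')) := by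
  intro h
  have hle : Ideal.span (Set.range (pt ∘ rels')) ≤ RingHom.ker ev := by
    rw [Ideal.span_le]
    rintro _ ⟨j, rfl⟩
    rw [SetLike.mem_coe, RingHom.mem_ker, Function.comp_apply]
    fin_cases j
    · simp [rels', pt_rels'.1, ev]
    · simp [rels', pt_rels'.2, ev]
  have := hle h
  simp [RingHom.mem_ker, ev] at this

/-- **The typed inference shape `C60L75` is FALSE on this instance** (both hypotheses hold by construction; `pt` is
Def.-5.4-shaped by `pt_shape`; the conclusion would put `b²` in `⟨t − a·b², t⟩`). A verdict on HU-R02 therefore needs the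
specific equations of Hu's charts; this toy decides nothing about them.
[cite: Hu2025, Lem. 7.4 (1) proof C60L71–L79 «We then take the proper transforms of these equations …»; p.135 (unrefereed manuscript under adjudication — kernel fact about the typed shape on a toy instance that is NOT one of the manuscript's charts, nothing of the manuscript asserted or denied)] -/
theorem not_C60L75_toy : ¬ C60L75 (π : A →+* A) (X 0) pt rels' D' D := by
  intro h
  have hconc : D.zIdeal = Ideal.span (Set.range (pt ∘ rels')) := h rfl rfl
  have hmem : (X 1 ^ 2 : A) ∈ D.zIdeal := X1_sq_mem_sat
  rw [hconc] at hmem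
  exact X1_sq_notMem_span_pt hmem

/-- Consistency with the criterion `GammaTransformChart.C60L75_conclusion_iff_saturated`: on the toy the ideal of the transformed
equations `⟨t − a·b², t⟩ = ⟨t, a·b²⟩` is NOT `a`-saturated (`b²·a ∈ ⟨t, a·b²⟩`, `b² ∉`).
[cite: Hu2025, Lem. 7.4 (1) proof C60L71–L79; p.135 (unrefereed manuscript under adjudication — kernel fact on a toy instance that is NOT one of the manuscript's charts, nothing asserted or denied)] -/
theorem not_saturated_toy :
    ¬ ∀ x : A, x * X 0 ∈ Ideal.span (Set.range (pt ∘ rels')) → x ∈ Ideal.span (Set.range (pt ∘ rels')) := by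
  have hpt : ∀ i, ∃ n : ℕ, pt (rels' i) * X 0 ^ n = (π : A →+* A) (rels' i) := by
    intro i
    fin_cases i
    · exact ⟨1, by simpa [rels'] using pt_shape.1⟩
    · exact ⟨0, by simpa [rels'] using pt_shape.2⟩
  rw [← GammaTransformChart.C60L75_conclusion_iff_saturated (π : A →+* A) (X 0) pt rels' D' D rfl rfl hpt]
  intro hconc
  exact not_C60L75_toy fun _ _ => hconc

end C60L75Toy

end Literature.AlgebraicGeometry.Hu2025.Statements.S07GammaSchemes

end
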